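import Literature.NumberTheory.Sieve.DrappeauDispersionS1Poisson
import HarnessLib

/-!
# Drappeau 2017, §5.5: truncation of the frequency sum `ℛ₁` of `𝒮₁`

Topic `Literature/NumberTheory/Sieve`, part of the formalisation of §5 of S. Drappeau, Proc. London
Math. Soc. (3) 114 (2017) 684–732 = arXiv:1504.05549 (Theorem 5.1 = the named fact
`Literature.NumberTheory.Sieve.Drappeau2017_theorem51`).  Everything here is PROVED; no definition
and no named fact is introduced.

`DrappeauDispersionS1Poisson` gives the exact identity `𝒮₁ = A₀X₁ + (all frequencies h ∉ Wℤ)`.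
§5.5 of the paper (arXiv p. 20) works with the TRUNCATED sum
`ℛ₁ = ∑ γγββ̄ ∑_{0<|h|≤H} W⁻¹ α̂(h/W) e(hμ/W)`, `H = W^{1+ε}M^{−1}`, the frequencies `|h| > H` being
negligible by the decay of `α̂`.  Here:

* `Drappeau2017.norm_tsum_freq_sub_sum_Icc_le` — for a smooth compactly supported `ψ`, `W ≥ 1`,
  `M > 0`, a twist `|c(h)| ≤ 1`, `H ≥ 1` and `n ≥ 2`:
  `|∑_{h ∉ Wℤ} ψ̂(Mh/W) c(h) − ∑_{|h| ≤ H, h ∉ Wℤ} ψ̂(Mh/W) c(h)| ≤ 2 (∫|ψ⁽ⁿ⁾|) (W/(2πM))ⁿ H^{1−n}`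
  (integration by parts `n` times, `FriedlanderIwaniecPrimes.sum_tail_norm_fourier_div_le`);
* `Drappeau2017.norm_dispS1_sub_mainX1_sub_freqTrunc_le` — consequently
  `|𝒮₁ − A₀X₁ − ℛ₁^{≤H}| ≤ ∑_{q₁,q₂} |γ(q₁)γ(q₂)| (∑_n |β_n|)² (M/W) · 2(∫|ψ⁽ⁿ⁾|)(W/(2πM))ⁿ H^{1−n}`
  with `ℛ₁^{≤H}` the truncated frequency sum written out (the `b`-sum over the CRT class has at most
  one term, `card_range_lcm_filter_eq`).

## References

* S. Drappeau, Proc. London Math. Soc. (3) 114 (2017) 684–732, arXiv:1504.05549, §5.5 (definition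
  of `ℛ₁`, `H = W^{1+ε}M^{−1}`). [cite: Drappeau2017, §5.5]
-/

noncomputable section

open Finset Real Complex MeasureTheory
open scoped FourierTransform ContDiff

namespace Literature.NumberTheory.Sieve

namespace Drappeau2017

open Literature.NumberTheory.Sieve.FriedlanderIwaniecPrimes (summable_fourier_div
  sum_tail_norm_fourier_div_le norm_fourier_le_integral_norm)

/-! ### Truncating the frequencies -/

/-- **Truncation of the dual sum**: for `ψ` smooth with compact support, `M > 0`, `W ≥ 1`, a twist
`|c(h)| ≤ 1`, `H ≥ 1`, `n ≥ 2`: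
`|∑_{h ∈ ℤ∖Wℤ} ψ̂(Mh/W) c(h) − ∑_{|h|≤H, h∉Wℤ} ψ̂(Mh/W) c(h)| ≤ 2 (∫|ψ⁽ⁿ⁾|) (W/(2πM))ⁿ H^{1−n}`.
[cite: Drappeau2017, §5.5] -/
theorem norm_tsum_freq_sub_sum_Icc_le {ψ : ℝ → ℂ} (hψ : ContDiff ℝ ∞ ψ) (hψc : HasCompactSupport ψ)
    {M : ℝ} (hM : 0 < M) {W : ℕ} (hW : 0 < W) {c : ℤ → ℂ} (hc : ∀ h, ‖c h‖ ≤ 1) {H : ℕ}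
    (hH : 1 ≤ H) {n : ℕ} (hn : 2 ≤ n) :
    ‖∑' h : ℤ, (if (W : ℤ) ∣ h then 0 else 𝓕 ψ (M * h / W) * c h) -
        ∑ h ∈ Finset.Icc (-(H : ℤ)) H, (if (W : ℤ) ∣ h then 0 else 𝓕 ψ (M * h / W) * c h)‖ ≤
      2 * (∫ t, ‖iteratedDeriv n ψ t‖) * ((W : ℝ) / (2 * π * M)) ^ n * (((H : ℝ) ^ (n - 1)))⁻¹ := by
  set D : ℝ := (W : ℝ) / M with hD
  have hWr : (0 : ℝ) < W := by exact_mod_cast hW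
  have hD0 : 0 < D := div_pos hWr hM
  set In : ℝ := ∫ t, ‖iteratedDeriv n ψ t‖ with hIn
  have hInn : 0 ≤ In := integral_nonneg fun _ => norm_nonneg _
  set Φ : ℤ → ℂ := fun h => if (W : ℤ) ∣ h then 0 else 𝓕 ψ (M * h / W) * c h with hΦ
  have harg : ∀ h : ℤ, M * h / (W : ℝ) = h / D := by intro h; rw [hD]; field_simp
  have hΦle : ∀ h : ℤ, ‖Φ h‖ ≤ ‖𝓕 ψ ((h : ℝ) / D)‖ := by
    intro h
    simp only [hΦ]
    split_ifs
    · simp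
    · rw [norm_mul, harg]
      calc ‖𝓕 ψ ((h : ℝ) / D)‖ * ‖c h‖ ≤ ‖𝓕 ψ ((h : ℝ) / D)‖ * 1 :=
            mul_le_mul_of_nonneg_left (hc h) (norm_nonneg _)
        _ = _ := mul_one _
  have hΦs : Summable Φ :=
    Summable.of_norm_bounded (summable_fourier_div hψ hψc hD0).norm hΦle
  -- the tail function
  set Φ' : ℤ → ℂ := fun h => if h ∈ Finset.Icc (-(H : ℤ)) H then 0 else Φ h with hΦ'
  have hΦ'le : ∀ h : ℤ, ‖Φ' h‖ ≤ (if h ∈ Finset.Icc (-(H : ℤ)) H then 0 else ‖𝓕 ψ ((h : ℝ) / D)‖) := by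
    intro h
    simp only [hΦ']
    split_ifs
    · simp
    · exact hΦle h
  have hΦ'le2 : ∀ h : ℤ, ‖Φ' h‖ ≤ ‖𝓕 ψ ((h : ℝ) / D)‖ := by
    intro h
    refine (hΦ'le h).trans ?_
    split_ifs
    · positivity
    · exact le_rfl
  have hΦ's : Summable fun h : ℤ => ‖Φ' h‖ :=
    Summable.of_nonneg_of_le (fun _ => norm_nonneg _) hΦ'le2 (summable_fourier_div hψ hψc hD0).norm
  -- `∑' Φ - ∑_{Icc} Φ = ∑' Φ'`
  have hfin : ∑' h : ℤ, (if h ∈ Finset.Icc (-(H : ℤ)) H then Φ h else 0) =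
      ∑ h ∈ Finset.Icc (-(H : ℤ)) H, Φ h := by
    rw [tsum_eq_sum (s := Finset.Icc (-(H : ℤ)) H) (fun h hh => if_neg hh)]
    exact Finset.sum_congr rfl fun h hh => if_pos hh
  have hdecomp : ∀ h : ℤ, Φ h = (if h ∈ Finset.Icc (-(H : ℤ)) H then Φ h else 0) + Φ' h := by
    intro h
    simp only [hΦ']
    split_ifs <;> simp
  have hs1 : Summable fun h : ℤ => (if h ∈ Finset.Icc (-(H : ℤ)) H then Φ h else 0) :=
    summable_of_ne_finset_zero (s := Finset.Icc (-(H : ℤ)) H) (fun h hh => if_neg hh)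
  have heq : ∑' h : ℤ, Φ h - ∑ h ∈ Finset.Icc (-(H : ℤ)) H, Φ h = ∑' h : ℤ, Φ' h := by
    rw [tsum_congr hdecomp, hs1.tsum_add hΦ's.of_norm, hfin, add_sub_cancel_left]
  rw [heq]
  -- bound the tail by partial sums
  set R : ℝ := 2 * In * (D / (2 * π)) ^ n * (((H : ℝ) ^ (n - 1)))⁻¹ with hR
  have hpartial : ∀ u : Finset ℤ, ∑ h ∈ u, ‖Φ' h‖ ≤ R := by
    intro u
    obtain ⟨N₀, hsub₀⟩ := Polymath8a.exists_subset_Icc_neg u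
    set N : ℕ := max N₀ H with hN
    have hsub : u ⊆ Finset.Icc (-(N : ℤ)) N := hsub₀.trans (by
      intro h hh; rw [Finset.mem_Icc] at hh ⊢; constructor <;> omega)
    refine (Finset.sum_le_sum_of_subset_of_nonneg hsub fun _ _ _ => norm_nonneg _).trans ?_
    refine (Finset.sum_le_sum fun h _ => hΦ'le h).trans ?_
    rw [Polymath8a.sum_Icc_neg_eq _ N]
    have h0 : (if (0 : ℤ) ∈ Finset.Icc (-(H : ℤ)) H then (0 : ℝ) else ‖𝓕 ψ (((0 : ℤ) : ℝ) / D)‖) = 0 := by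
      rw [if_pos]; rw [Finset.mem_Icc]; constructor <;> omega
    rw [h0, zero_add]
    have hpair : ∀ ν ∈ Finset.Icc 1 N,
        ((if ((ν : ℕ) : ℤ) ∈ Finset.Icc (-(H : ℤ)) H then (0 : ℝ) else ‖𝓕 ψ ((((ν : ℕ) : ℤ) : ℝ) / D)‖) +
          (if (-((ν : ℕ) : ℤ)) ∈ Finset.Icc (-(H : ℤ)) H then (0 : ℝ) else
            ‖𝓕 ψ (((-((ν : ℕ) : ℤ) : ℤ) : ℝ) / D)‖)) =
        if ¬ ν ≤ H then (‖𝓕 ψ ((ν : ℝ) / D)‖ + ‖𝓕 ψ (-(ν : ℝ) / D)‖) else 0 := by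
      intro ν hν
      have hν1 : 1 ≤ ν := (Finset.mem_Icc.1 hν).1
      by_cases hνH : ν ≤ H
      · have h1 : ((ν : ℕ) : ℤ) ∈ Finset.Icc (-(H : ℤ)) H := by
          rw [Finset.mem_Icc]; constructor <;> omega
        have h2 : (-((ν : ℕ) : ℤ)) ∈ Finset.Icc (-(H : ℤ)) H := by
          rw [Finset.mem_Icc]; constructor <;> omega
        rw [if_pos h1, if_pos h2, if_neg (not_not.mpr hνH), add_zero]
      · have h1 : ((ν : ℕ) : ℤ) ∉ Finset.Icc (-(H : ℤ)) H := by
          rw [Finset.mem_Icc]; omega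
        have h2 : (-((ν : ℕ) : ℤ)) ∉ Finset.Icc (-(H : ℤ)) H := by
          rw [Finset.mem_Icc]; omega
        rw [if_neg h1, if_neg h2, if_pos hνH]
        push_cast
        ring_nf
    rw [Finset.sum_congr rfl hpair, ← Finset.sum_filter]
    have hfilt : (Finset.Icc 1 N).filter (fun ν => ¬ ν ≤ H) = Finset.Ioc H N := by
      ext ν
      simp only [Finset.mem_filter, Finset.mem_Icc, Finset.mem_Ioc, not_le]
      omega
    rw [hfilt]
    exact sum_tail_norm_fourier_div_le hψ hψc hn hD0 hH N
  have htsum : ∑' h : ℤ, ‖Φ' h‖ ≤ R := Real.tsum_le_of_sum_le (fun _ => norm_nonneg _) hpartial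
  have hDn : D / (2 * π) = (W : ℝ) / (2 * π * M) := by rw [hD, div_div, mul_comm M]
  calc ‖∑' h : ℤ, Φ' h‖ ≤ ∑' h : ℤ, ‖Φ' h‖ := norm_tsum_le_tsum_norm hΦ's
    _ ≤ R := htsum
    _ = _ := by rw [hR, hDn]

/-! ### `|𝒮₁ − A₀X₁ − ℛ₁^{≤H}|` -/

/-- **Drappeau 2017, §5.5: the truncated frequency sum.**  With the objects of
`dispS1_eq_mainX1_add_freq` (`α = BFI.bump M (M/2)`, `ψ = BFI.bumpC 1 (1/2)`, `A₀ = ∑_m α(m)`,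
`W = [q₁,q₂]`), for `H ≥ 1` and `n ≥ 2`:
`|𝒮₁ − A₀X₁ − ∑_{q₁,q₂} γγ ∑_{n₁,n₂} ββ̄ (M/W) ∑_{b} ∑_{|h|≤H, h∉Wℤ} ψ̂(Mh/W) e(bh/W)|`
`≤ ∑_{q₁,q₂} |γ(q₁)γ(q₂)| (∑_n |β_n|)² (M/W) · 2(∫|ψ⁽ⁿ⁾|)(W/(2πM))ⁿ H^{1−n}`
(the paper's `ℛ₁` is the truncated sum with `H = W^{1+ε}/M`, the rest being `O(M^{−A})`).
[cite: Drappeau2017, §5.5] -/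
theorem norm_dispS1_sub_mainX1_sub_freqTrunc_le (a₁ a₂ : ℤ) {𝒬 : Finset ℕ} (h𝒬 : ∀ q ∈ 𝒬, 0 < q)
    (𝒩 : Finset ℕ) (γ : ℕ → ℝ) (β : ℕ → ℂ) {M : ℝ} (hM : 0 < M) {H : ℕ} (hH : 1 ≤ H) {n : ℕ}
    (hn : 2 ≤ n) :
    ‖dispS1 a₁ a₂ 𝒬 (BFI.mRange M (M / 2)) 𝒩 γ (fun m : ℕ => BFI.bump M (M / 2) m) β -
        ((∑ m ∈ BFI.mRange M (M / 2), BFI.bump M (M / 2) m : ℝ) : ℂ) * mainX1 a₁ a₂ 𝒬 𝒩 γ β -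
        ∑ q₁ ∈ 𝒬.filter (fun q : ℕ => IsCoprime (q : ℤ) (a₁ * a₂)),
          ∑ q₂ ∈ 𝒬.filter (fun q : ℕ => IsCoprime (q : ℤ) (a₁ * a₂)), (γ q₁ : ℂ) * (γ q₂ : ℂ) *
            ∑ n₁ ∈ 𝒩.filter (fun n : ℕ => IsCoprime (n : ℤ) a₂),
              ∑ n₂ ∈ 𝒩.filter (fun n : ℕ => IsCoprime (n : ℤ) a₂), β n₁ * starRingEnd ℂ (β n₂) *
                ((M : ℂ) / (Nat.lcm q₁ q₂ : ℂ) *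
                  ∑ b ∈ (Finset.range (Nat.lcm q₁ q₂)).filter (fun b : ℕ =>
                      (b : ZMod q₁) * ((n₁ : ZMod q₁) * (a₂ : ZMod q₁)) = (a₁ : ZMod q₁) ∧
                      (b : ZMod q₂) * ((n₂ : ZMod q₂) * (a₂ : ZMod q₂)) = (a₁ : ZMod q₂)),
                    ∑ h ∈ Finset.Icc (-(H : ℤ)) H, (if ((Nat.lcm q₁ q₂ : ℕ) : ℤ) ∣ h then 0 else
                      𝓕 (BFI.bumpC 1 (1 / 2)) (M * h / (Nat.lcm q₁ q₂ : ℕ)) *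
                        (𝐞 ((b : ℝ) * h / (Nat.lcm q₁ q₂ : ℕ)) : ℂ)))‖ ≤
      ∑ q₁ ∈ 𝒬.filter (fun q : ℕ => IsCoprime (q : ℤ) (a₁ * a₂)),
        ∑ q₂ ∈ 𝒬.filter (fun q : ℕ => IsCoprime (q : ℤ) (a₁ * a₂)), |γ q₁ * γ q₂| *
          ((∑ n ∈ 𝒩.filter (fun n : ℕ => IsCoprime (n : ℤ) a₂), ‖β n‖) ^ 2 *
            (M / (Nat.lcm q₁ q₂ : ℝ) * (2 * (∫ t, ‖iteratedDeriv n (BFI.bumpC 1 (1 / 2)) t‖) *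
              ((Nat.lcm q₁ q₂ : ℝ) / (2 * π * M)) ^ n * (((H : ℝ) ^ (n - 1)))⁻¹))) := by
  rw [dispS1_eq_mainX1_add_freq a₁ a₂ h𝒬 𝒩 γ β hM, add_sub_cancel_left, ← Finset.sum_sub_distrib]
  set ψ : ℝ → ℂ := BFI.bumpC 1 (1 / 2) with hψdef
  have hψ : ContDiff ℝ ∞ ψ := BFI.contDiff_bumpC 1 (1 / 2)
  have hψc : HasCompactSupport ψ := BFI.hasCompactSupport_bumpC (by norm_num) zero_le_one
  refine (norm_sum_le _ _).trans (Finset.sum_le_sum fun q₁ hq₁ => ?_)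
  rw [← Finset.sum_sub_distrib]
  refine (norm_sum_le _ _).trans (Finset.sum_le_sum fun q₂ hq₂ => ?_)
  have hq₁m := Finset.mem_filter.1 hq₁
  have hq₂m := Finset.mem_filter.1 hq₂
  have hq₁0 : 0 < q₁ := h𝒬 q₁ hq₁m.1
  have hq₂0 : 0 < q₂ := h𝒬 q₂ hq₂m.1
  obtain ⟨ha₁, ha₂⟩ := isUnit_of_isCoprime_mul hq₁m.2
  obtain ⟨ha₁', ha₂'⟩ := isUnit_of_isCoprime_mul hq₂m.2
  set W := Nat.lcm q₁ q₂ with hWdef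
  have hW : 0 < W := Nat.lcm_pos hq₁0 hq₂0
  have hWr : (0 : ℝ) < W := by exact_mod_cast hW
  set Tail : ℝ := 2 * (∫ t, ‖iteratedDeriv n ψ t‖) * ((W : ℝ) / (2 * π * M)) ^ n *
    (((H : ℝ) ^ (n - 1)))⁻¹ with hTail
  have hTail0 : 0 ≤ Tail := by
    have : 0 ≤ ∫ t, ‖iteratedDeriv n ψ t‖ := integral_nonneg fun _ => norm_nonneg _
    positivity
  -- the difference of the two frequency sums, per `b`
  have hdiff : ∀ b : ℕ, ‖∑' h : ℤ, (if (W : ℤ) ∣ h then 0 else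
        𝓕 ψ (M * h / W) * (𝐞 ((b : ℝ) * h / W) : ℂ)) -
      ∑ h ∈ Finset.Icc (-(H : ℤ)) H, (if (W : ℤ) ∣ h then 0 else
        𝓕 ψ (M * h / W) * (𝐞 ((b : ℝ) * h / W) : ℂ))‖ ≤ Tail := by
    intro b
    exact norm_tsum_freq_sub_sum_Icc_le hψ hψc hM hW (c := fun h : ℤ => (𝐞 ((b : ℝ) * h / W) : ℂ))
      (fun h => by rw [Circle.norm_coe]) hH hn
  -- the `b`-sums have at most one term
  have hcard : ∀ n₁ n₂ : ℕ, (((Finset.range W).filter (fun b : ℕ =>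
      (b : ZMod q₁) * ((n₁ : ZMod q₁) * (a₂ : ZMod q₁)) = (a₁ : ZMod q₁) ∧
      (b : ZMod q₂) * ((n₂ : ZMod q₂) * (a₂ : ZMod q₂)) = (a₁ : ZMod q₂))).card : ℝ) ≤ 1 := by
    intro n₁ n₂
    rw [hWdef, card_range_lcm_filter_eq hq₁0 hq₂0 ha₁ ha₁' ha₂ ha₂' n₁ n₂]
    split_ifs <;> simp
  rw [← mul_sub, ← Finset.sum_sub_distrib, norm_mul, norm_mul, Complex.norm_real, Complex.norm_real,
    Real.norm_eq_abs, Real.norm_eq_abs, ← abs_mul]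
  refine mul_le_mul_of_nonneg_left ?_ (abs_nonneg _)
  -- the `n`-sums
  have hn₂ : ∀ n₁ ∈ 𝒩.filter (fun n : ℕ => IsCoprime (n : ℤ) a₂),
      ‖∑ n₂ ∈ 𝒩.filter (fun n : ℕ => IsCoprime (n : ℤ) a₂), β n₁ * starRingEnd ℂ (β n₂) *
          ((M : ℂ) / (W : ℂ) * ∑ b ∈ (Finset.range W).filter (fun b : ℕ =>
              (b : ZMod q₁) * ((n₁ : ZMod q₁) * (a₂ : ZMod q₁)) = (a₁ : ZMod q₁) ∧
              (b : ZMod q₂) * ((n₂ : ZMod q₂) * (a₂ : ZMod q₂)) = (a₁ : ZMod q₂)),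
            ∑' h : ℤ, (if (W : ℤ) ∣ h then 0 else 𝓕 ψ (M * h / W) * (𝐞 ((b : ℝ) * h / W) : ℂ))) -
        ∑ n₂ ∈ 𝒩.filter (fun n : ℕ => IsCoprime (n : ℤ) a₂), β n₁ * starRingEnd ℂ (β n₂) *
          ((M : ℂ) / (W : ℂ) * ∑ b ∈ (Finset.range W).filter (fun b : ℕ =>
              (b : ZMod q₁) * ((n₁ : ZMod q₁) * (a₂ : ZMod q₁)) = (a₁ : ZMod q₁) ∧
              (b : ZMod q₂) * ((n₂ : ZMod q₂) * (a₂ : ZMod q₂)) = (a₁ : ZMod q₂)),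
            ∑ h ∈ Finset.Icc (-(H : ℤ)) H, (if (W : ℤ) ∣ h then 0 else
              𝓕 ψ (M * h / W) * (𝐞 ((b : ℝ) * h / W) : ℂ)))‖ ≤
      ∑ n₂ ∈ 𝒩.filter (fun n : ℕ => IsCoprime (n : ℤ) a₂), ‖β n₁‖ * ‖β n₂‖ * (M / W * Tail) := by
    intro n₁ _
    rw [← Finset.sum_sub_distrib]
    refine (norm_sum_le _ _).trans (Finset.sum_le_sum fun n₂ _ => ?_)
    rw [← mul_sub, ← mul_sub, ← Finset.sum_sub_distrib, norm_mul, norm_mul, Complex.norm_conj,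
      norm_mul, norm_div, Complex.norm_real, Complex.norm_natCast, Real.norm_eq_abs, abs_of_pos hM]
    refine mul_le_mul_of_nonneg_left (mul_le_mul_of_nonneg_left ?_ (by positivity)) (by positivity)
    refine (norm_sum_le _ _).trans ?_
    refine (Finset.sum_le_sum fun b _ => hdiff b).trans ?_
    rw [Finset.sum_const, nsmul_eq_mul]
    calc _ ≤ 1 * Tail := mul_le_mul_of_nonneg_right (hcard n₁ n₂) hTail0
      _ = Tail := one_mul _
  refine (norm_sum_le _ _).trans ((Finset.sum_le_sum hn₂).trans (le_of_eq ?_))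
  rw [sq, Finset.sum_mul_sum, Finset.sum_mul]
  refine Finset.sum_congr rfl fun n₁ _ => ?_
  rw [Finset.sum_mul]

end Drappeau2017

end Literature.NumberTheory.Sieve

end
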